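import Summits.QuantumFields.YangMills.Theorems.BalabanUVNodesN15KingModelAnalyticDeterminantSecondOrderTaylor
import Summits.QuantumFields.YangMills.Theorems.BalabanUVNodesN15KingModelComplexLinkOperator
import HarnessLib

/-!
# BalabanUVNodes ∕ N15 — THE KING-MODEL RUNG (PART Ϯ-k): TOOLS FOR THE DECOUPLING OF DISTANT BACKGROUND PERTURBATIONS — the connected second difference of a function of two
# parameters is controlled by its mixed derivative (`|F(1) − F(0)| ≤ sup|F′|` twice); the trace `tr(P·E₁·Q·E₂)` of a product with two perturbations `E₁, E₂` supported on index sets `T₁, T₂` is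
# bounded by the CROSS entries of `P` (`T₂ → T₁`) and `Q` (`T₁ → T₂`) times the ℓ¹ sizes of `E₁, E₂`; and the two-sided hopping matrix `T_{A,B}` (PART Ϛ `cxHop`) of fields supported on a bond
# set `Z` is supported on the endpoints of `Z` with ℓ¹ size `≤ c·Σ_b(‖A(b)‖₁ + ‖B(b)‖₁)`
# (Track A, DAG node N15 = NE2; FAN-OUT v1.1 §N15 s3 «KING-MODEL RUNG … + what the curved case adds»; count-neutral)

HONEST FRAMING.  Count-neutral (cell `pub-ymgap`, seat `pub-ymgap-dag-n15-e` g54; `--supports stmt-QuantumFields-27247 --as helper` = K3ᴬ, KEY MAP v3).  Elementary real analysis on `[0,1]`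
and finite-matrix bookkeeping (any `RCLike` field; King's hopping datum on the torus `Π_μℤ∕K_μ` for §3), in the shape PART Ϯ-l (DECOUPLING of King's Gaussian normalisation across two distant
bond sets) consumes them.  NOT Bałaban's (3.42); NOT a node discharge (N15 of record untouched); nothing continuum ∕ ℝ⁴ ∕ OS ∕ Clay.

CONTENT.  §1 ★ `abs_sub_le_of_hasDerivAt_abs_le` (`|ψ′| ≤ B` on `[0,1]` ⟹ `|ψ(1) − ψ(0)| ≤ B`, Ϯ-h's monotonicity passes); §2 ★ `abs_re_trace_mul_le_of_norm_entry_le_on` (Ϯ-a's trace bound with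
the entry bound on `P` required only AGAINST THE SUPPORT of `E`), ★ `norm_triple_mul_entry_le` (`‖(PE₁Q)_{αδ}‖ ≤ b_P·b_Q·‖E₁‖₁` from cross bounds `‖P_{αβ}‖ ≤ b_P` (`β ∈ T₁`), `‖Q_{γδ}‖ ≤ b_Q`
(`γ ∈ T₁`)), ★★ **`abs_re_trace_mul4_le`** (`|Re tr(PE₁QE₂)| ≤ b_P·b_Q·‖E₁‖₁·‖E₂‖₁` — only the CROSS entries `T₂ → T₁` of `P` and `T₁ → T₂` of `Q` enter); §3 (King datum, PART Ϛ's two-sided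
hopping matrix `cxHop K c A B = c·Σ_b(E_{x,x+e_μ}(A(b)) + E_{x+e_μ,x}(B(b)))`): `sum_norm_placed_entry`, ★ `cxHop_apply_eq_zero_of_fst`∕`_of_snd` (fields vanishing off `Z` ⟹ `T_{A,B}` vanishes at
rows∕columns whose site is no endpoint of `Z`), ★ `sum_norm_cxHop_entry_le` (`Σ‖(T_{A,B})_{pq}‖ ≤ c·Σ_b(Σ‖A(b)_{ij}‖ + Σ‖B(b)_{ij}‖)`).

PRIOR TREE ART (by name, not restated): Ϯ-h `nonpos_of_hasDerivAt_nonpos_Icc`∕`nonneg_of_hasDerivAt_nonneg_Icc`, Ϛ-a `cxHop` (`…ComplexLinkOperator`), `LatticeDiamagneticInequality.placed`.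
Dedup (rg at filing): basename 0 files; `abs_sub_le_of_hasDerivAt_abs_le|abs_re_trace_mul_le_of_norm_entry_le_on|norm_triple_mul_entry_le|abs_re_trace_mul4_le|cxHop_apply_eq_zero_of_fst|sum_norm_cxHop_entry_le` 0 tree files.
Locators: [King1986] (2.13) p.653, (3.94)–(3.96) p.669, (4.4) p.670; [Balaban1985BackgroundPropagators] (3.23) p.394, §3.B p.399 l.37–40.  0 `sorry`, 0 `def`.
-/

noncomputable section

open scoped BigOperators ComplexConjugate ComplexOrder
open Finset Matrix Set

namespace Summit.QuantumFields.YangMills.BalabanUVNodes.N15KingModelRung.Analytic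

open Literature.MathematicalPhysics.QuantumFieldTheory.LatticeDiamagneticInequality (placed)
open Literature.MathematicalPhysics.QuantumFieldTheory.Balaban1983to89.B5Prop11Plancherel (Tor unitVec)
open Summit.QuantumFields.YangMills.BalabanUVNodes.N15KingModelRung.Covariant (cxHop)

/-! ## §1 `|ψ(1) − ψ(0)| ≤ sup |ψ′|` on `[0,1]` -/

section MVT

/-- ★ If `|ψ′| ≤ B` on `[0,1]` then `|ψ(1) − ψ(0)| ≤ B` (two monotonicity passes on `ψ(s) − ψ(0) ∓ Bs`). [folklore] -/
theorem abs_sub_le_of_hasDerivAt_abs_le {ψ ψ' : ℝ → ℝ} {B : ℝ} (hψ : ∀ s ∈ Icc (0 : ℝ) 1, HasDerivAt ψ (ψ' s) s) (hB : ∀ s ∈ Icc (0 : ℝ) 1, |ψ' s| ≤ B) :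
    |ψ 1 - ψ 0| ≤ B := by
  have hup := nonpos_of_hasDerivAt_nonpos_Icc (ψ := fun s => ψ s - ψ 0 - B * s) (ψ' := fun s => ψ' s - B)
    (fun x hx => ((hψ x hx).sub_const (ψ 0)).sub ((hasDerivAt_id x).const_mul B |>.congr_deriv (by simp)))
    (fun x hx => by linarith [(abs_le.mp (hB x hx)).2]) (by simp) (right_mem_Icc.mpr zero_le_one)
  have hdn := nonneg_of_hasDerivAt_nonneg_Icc (ψ := fun s => ψ s - ψ 0 + B * s) (ψ' := fun s => ψ' s + B)
    (fun x hx => ((hψ x hx).sub_const (ψ 0)).add ((hasDerivAt_id x).const_mul B |>.congr_deriv (by simp)))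
    (fun x hx => by linarith [(abs_le.mp (hB x hx)).1]) (by simp) (right_mem_Icc.mpr zero_le_one)
  simp only [mul_one] at hup hdn
  rw [abs_le]; constructor <;> linarith

end MVT

/-! ## §2 Traces against two supported perturbations -/

section Trace

variable {𝕜 : Type*} [RCLike 𝕜] {ι : Type*} [Fintype ι]

/-- ★ `|Re tr(PE)| ≤ β·Σ_δΣ_α‖E_{δα}‖` as soon as `‖P_{αδ}‖ ≤ β` for the pairs `(α,δ)` with `E_{δα} ≠ 0` (Ϯ-a's bound, localised to the support of `E`). [cite: King1986, (2.13) p.653] -/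
theorem abs_re_trace_mul_le_of_norm_entry_le_on {P E : Matrix ι ι 𝕜} {β : ℝ} (hP : ∀ δ α, E δ α ≠ 0 → ‖P α δ‖ ≤ β) :
    |RCLike.re (P * E).trace| ≤ β * ∑ δ, ∑ α, ‖E δ α‖ := by
  rw [Matrix.trace]
  simp only [Matrix.diag_apply, Matrix.mul_apply, map_sum]
  have hpt : ∀ α δ, |RCLike.re (P α δ * E δ α)| ≤ β * ‖E δ α‖ := by
    intro α δ
    by_cases h0 : E δ α = 0
    · simp [h0]
    · calc |RCLike.re (P α δ * E δ α)| ≤ ‖P α δ * E δ α‖ := RCLike.abs_re_le_norm _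
        _ = ‖P α δ‖ * ‖E δ α‖ := norm_mul _ _
        _ ≤ β * ‖E δ α‖ := mul_le_mul_of_nonneg_right (hP δ α h0) (norm_nonneg _)
  calc |∑ α, ∑ δ, RCLike.re (P α δ * E δ α)|
      ≤ ∑ α, ∑ δ, |RCLike.re (P α δ * E δ α)| := (Finset.abs_sum_le_sum_abs _ _).trans (Finset.sum_le_sum fun α _ => Finset.abs_sum_le_sum_abs _ _)
    _ ≤ ∑ α, ∑ δ, β * ‖E δ α‖ := Finset.sum_le_sum fun α _ => Finset.sum_le_sum fun δ _ => hpt α δ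
    _ = β * ∑ δ, ∑ α, ‖E δ α‖ := by rw [Finset.sum_comm]; simp only [← Finset.mul_sum]

/-- ★ THE ENTRIES OF A TRIPLE PRODUCT AGAINST A SUPPORTED MIDDLE FACTOR: if `E₁_{βγ} ≠ 0` forces `T₁ β ∧ T₁ γ`, `‖P_{αβ}‖ ≤ b_P` for `T₁ β` and `‖Q_{γδ}‖ ≤ b_Q` for `T₁ γ`, then
`‖(P·E₁·Q)_{αδ}‖ ≤ b_P·b_Q·Σ_βΣ_γ‖E₁_{βγ}‖`. [cite: King1986, (3.94)–(3.96) p.669] -/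
theorem norm_triple_mul_entry_le {P E₁ Q : Matrix ι ι 𝕜} {T₁ : ι → Prop} {bP bQ : ℝ} (hbP : 0 ≤ bP)
    (hE₁ : ∀ β γ, E₁ β γ ≠ 0 → T₁ β ∧ T₁ γ) (α δ : ι) (hP : ∀ β, T₁ β → ‖P α β‖ ≤ bP) (hQ : ∀ γ, T₁ γ → ‖Q γ δ‖ ≤ bQ) :
    ‖(P * E₁ * Q) α δ‖ ≤ bP * bQ * ∑ β, ∑ γ, ‖E₁ β γ‖ := by
  simp only [Matrix.mul_apply, Finset.sum_mul]
  have hpt : ∀ γ β, ‖P α β * E₁ β γ * Q γ δ‖ ≤ bP * bQ * ‖E₁ β γ‖ := by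
    intro γ β
    by_cases h0 : E₁ β γ = 0
    · simp [h0]
    · obtain ⟨hβ, hγ⟩ := hE₁ β γ h0
      rw [norm_mul, norm_mul]
      have h1 := hP β hβ
      have h2 := hQ γ hγ
      have h3 : ‖P α β‖ * ‖E₁ β γ‖ ≤ bP * ‖E₁ β γ‖ := mul_le_mul_of_nonneg_right h1 (norm_nonneg _)
      calc ‖P α β‖ * ‖E₁ β γ‖ * ‖Q γ δ‖ ≤ bP * ‖E₁ β γ‖ * bQ := mul_le_mul h3 h2 (norm_nonneg _) (by positivity)
        _ = bP * bQ * ‖E₁ β γ‖ := by ring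
  calc ‖∑ γ, ∑ β, P α β * E₁ β γ * Q γ δ‖ ≤ ∑ γ, ‖∑ β, P α β * E₁ β γ * Q γ δ‖ := norm_sum_le _ _
    _ ≤ ∑ γ, ∑ β, ‖P α β * E₁ β γ * Q γ δ‖ := Finset.sum_le_sum fun γ _ => norm_sum_le _ _
    _ ≤ ∑ γ, ∑ β, bP * bQ * ‖E₁ β γ‖ := Finset.sum_le_sum fun γ _ => Finset.sum_le_sum fun β _ => hpt γ β
    _ = bP * bQ * ∑ β, ∑ γ, ‖E₁ β γ‖ := by rw [Finset.sum_comm]; simp only [← Finset.mul_sum]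

/-- ★★ **THE FOUR-FACTOR TRACE BOUND**: perturbations `E₁`, `E₂` supported on index sets `T₁`, `T₂` (`E₁_{βγ} ≠ 0 ⟹ T₁ β ∧ T₁ γ`, `E₂_{δα} ≠ 0 ⟹ T₂ δ ∧ T₂ α`) and CROSS bounds
`‖P_{αβ}‖ ≤ b_P` (`T₂ α`, `T₁ β`), `‖Q_{γδ}‖ ≤ b_Q` (`T₁ γ`, `T₂ δ`) give `|Re tr(P·E₁·Q·E₂)| ≤ b_P·b_Q·‖E₁‖₁·‖E₂‖₁` — the interaction of two distant perturbations only sees the propagator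
BETWEEN their supports. [cite: King1986, (3.94)–(3.96) p.669; Balaban1985BackgroundPropagators, (3.42) p.397] -/
theorem abs_re_trace_mul4_le {P E₁ Q E₂ : Matrix ι ι 𝕜} {T₁ T₂ : ι → Prop} {bP bQ : ℝ} (hbP : 0 ≤ bP)
    (hE₁ : ∀ β γ, E₁ β γ ≠ 0 → T₁ β ∧ T₁ γ) (hE₂ : ∀ δ α, E₂ δ α ≠ 0 → T₂ δ ∧ T₂ α)
    (hP : ∀ α β, T₂ α → T₁ β → ‖P α β‖ ≤ bP) (hQ : ∀ γ δ, T₁ γ → T₂ δ → ‖Q γ δ‖ ≤ bQ) :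
    |RCLike.re (P * E₁ * Q * E₂).trace| ≤ bP * bQ * (∑ β, ∑ γ, ‖E₁ β γ‖) * (∑ δ, ∑ α, ‖E₂ δ α‖) := by
  have h := abs_re_trace_mul_le_of_norm_entry_le_on (P := P * E₁ * Q) (E := E₂) (β := bP * bQ * ∑ β, ∑ γ, ‖E₁ β γ‖)
    (fun δ α hne => by
      obtain ⟨hδ, hα⟩ := hE₂ δ α hne
      exact norm_triple_mul_entry_le hbP hE₁ α δ (fun β hβ => hP α β hα hβ) (fun γ hγ => hQ γ δ hγ hδ))
  simpa [mul_assoc] using h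

end Trace

/-! ## §3 The two-sided hopping matrix of fields supported on a bond set -/

section Hopping

variable {d : ℕ} (K : Fin (d + 1) → ℕ) [hK : ∀ μ, NeZero (K μ)]
variable {𝕜 : Type*} [RCLike 𝕜] {n : Type*} [Fintype n] [DecidableEq n]

omit [DecidableEq n] in
/-- `Σ_pΣ_q‖E_{xy}(A)_{pq}‖ = Σ_iΣ_j‖A_{ij}‖`. [folklore] -/
theorem sum_norm_placed_entry (x y : Tor K) (A : Matrix n n 𝕜) : ∑ p : Tor K × n, ∑ q : Tor K × n, ‖placed x y A p q‖ = ∑ i, ∑ j, ‖A i j‖ := by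
  simp only [placed, Matrix.of_apply]
  rw [Fintype.sum_prod_type]
  simp_rw [Fintype.sum_prod_type (f := fun q : Tor K × n => ‖if x = _ ∧ y = q.1 then A _ q.2 else 0‖)]
  rw [Finset.sum_eq_single x (fun p1 _ hp1 => by simp [Ne.symm hp1]) (fun h => absurd (Finset.mem_univ _) h)]
  refine Finset.sum_congr rfl fun i _ => ?_
  rw [Finset.sum_eq_single y (fun q1 _ hq1 => by simp [Ne.symm hq1]) (fun h => absurd (Finset.mem_univ _) h)]
  simp

omit [Fintype n] [DecidableEq n] in
/-- ★ SUPPORT OF THE HOPPING MATRIX, ROWS: if `A` and `B` vanish off the bond set `Z` and the site of the row index `p` is no endpoint of a bond of `Z`, then `(T_{A,B})_{pq} = 0`.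
[cite: Balaban1985BackgroundPropagators, (3.23) p.394, §3.B p.399 l.37–40; King1986, (4.4) p.670] -/
theorem cxHop_apply_eq_zero_of_fst (c : ℝ) {A B : Tor K × Fin (d + 1) → Matrix n n 𝕜} {Z : Finset (Tor K × Fin (d + 1))}
    (hA : ∀ b, b ∉ Z → A b = 0) (hB : ∀ b, b ∉ Z → B b = 0) {p : Tor K × n} (hp : ∀ b ∈ Z, p.1 ≠ b.1 ∧ p.1 ≠ b.1 + unitVec K b.2) (q : Tor K × n) :
    cxHop K c A B p q = 0 := by
  simp only [cxHop, Matrix.sum_apply, Matrix.smul_apply, Matrix.add_apply, placed, Matrix.of_apply, smul_eq_mul]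
  refine Finset.sum_eq_zero fun b _ => ?_
  by_cases hb : b ∈ Z
  · obtain ⟨h1, h2⟩ := hp b hb
    rw [if_neg (fun h => h1 h.1.symm), if_neg (fun h => h2 h.1.symm), add_zero, mul_zero]
  · simp [hA b hb, hB b hb]

omit [Fintype n] [DecidableEq n] in
/-- ★ SUPPORT OF THE HOPPING MATRIX, COLUMNS: the same for the column index `q`. [cite: Balaban1985BackgroundPropagators, (3.23) p.394; King1986, (4.4) p.670] -/
theorem cxHop_apply_eq_zero_of_snd (c : ℝ) {A B : Tor K × Fin (d + 1) → Matrix n n 𝕜} {Z : Finset (Tor K × Fin (d + 1))}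
    (hA : ∀ b, b ∉ Z → A b = 0) (hB : ∀ b, b ∉ Z → B b = 0) (p : Tor K × n) {q : Tor K × n} (hq : ∀ b ∈ Z, q.1 ≠ b.1 ∧ q.1 ≠ b.1 + unitVec K b.2) :
    cxHop K c A B p q = 0 := by
  simp only [cxHop, Matrix.sum_apply, Matrix.smul_apply, Matrix.add_apply, placed, Matrix.of_apply, smul_eq_mul]
  refine Finset.sum_eq_zero fun b _ => ?_
  by_cases hb : b ∈ Z
  · obtain ⟨h1, h2⟩ := hq b hb
    rw [if_neg (fun h => h2 h.2.symm), if_neg (fun h => h1 h.2.symm), add_zero, mul_zero]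
  · simp [hA b hb, hB b hb]

omit [DecidableEq n] in
/-- ★ THE ℓ¹ SIZE OF THE HOPPING MATRIX: `Σ_pΣ_q‖(T_{A,B})_{pq}‖ ≤ c·Σ_b(Σ_{ij}‖A(b)_{ij}‖ + Σ_{ij}‖B(b)_{ij}‖)` (`c ≥ 0`). [cite: Balaban1985BackgroundPropagators, (3.23) p.394; King1986, (4.4) p.670] -/
theorem sum_norm_cxHop_entry_le {c : ℝ} (hc : 0 ≤ c) (A B : Tor K × Fin (d + 1) → Matrix n n 𝕜) :
    ∑ p : Tor K × n, ∑ q : Tor K × n, ‖cxHop K c A B p q‖ ≤ c * ∑ b, ((∑ i, ∑ j, ‖A b i j‖) + ∑ i, ∑ j, ‖B b i j‖) := by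
  have hterm : ∀ p q : Tor K × n, ‖cxHop K c A B p q‖ ≤ ∑ b, c * (‖placed b.1 (b.1 + unitVec K b.2) (A b) p q‖ + ‖placed (b.1 + unitVec K b.2) b.1 (B b) p q‖) := by
    intro p q
    simp only [cxHop, Matrix.sum_apply, Matrix.smul_apply, Matrix.add_apply, smul_eq_mul]
    refine (norm_sum_le _ _).trans (Finset.sum_le_sum fun b _ => ?_)
    rw [norm_mul, RCLike.norm_ofReal, abs_of_nonneg hc]
    exact mul_le_mul_of_nonneg_left (norm_add_le _ _) hc
  calc ∑ p : Tor K × n, ∑ q : Tor K × n, ‖cxHop K c A B p q‖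
      ≤ ∑ p : Tor K × n, ∑ q : Tor K × n, ∑ b, c * (‖placed b.1 (b.1 + unitVec K b.2) (A b) p q‖ + ‖placed (b.1 + unitVec K b.2) b.1 (B b) p q‖) :=
        Finset.sum_le_sum fun p _ => Finset.sum_le_sum fun q _ => hterm p q
    _ = ∑ b, ∑ p : Tor K × n, ∑ q : Tor K × n, c * (‖placed b.1 (b.1 + unitVec K b.2) (A b) p q‖ + ‖placed (b.1 + unitVec K b.2) b.1 (B b) p q‖) := by
        rw [Finset.sum_congr rfl fun p _ => Finset.sum_comm, Finset.sum_comm]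
    _ = c * ∑ b, ((∑ i, ∑ j, ‖A b i j‖) + ∑ i, ∑ j, ‖B b i j‖) := by
        rw [Finset.mul_sum]
        refine Finset.sum_congr rfl fun b _ => ?_
        rw [← sum_norm_placed_entry K b.1 (b.1 + unitVec K b.2) (A b), ← sum_norm_placed_entry K (b.1 + unitVec K b.2) b.1 (B b)]
        simp only [mul_add, Finset.mul_sum, Finset.sum_add_distrib]

end Hopping

end Summit.QuantumFields.YangMills.BalabanUVNodes.N15KingModelRung.Analytic

end
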